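import Mathlib
import HarnessLib
import Summits.NavierStokesRegularity.NavierStokesRegularity.Theorems.PoloidalWindowDoorLrcModEntireCurvedTimeWebAt

/-!
# Route `PoloidalWindowDoor`, item `LrcModEntire` (stmt-NavierStokesRegularity-20428), cell (Q4-curved) of the (TH) column —
# B-TWP0c IN END′ CURRENCY: the local `∀ σ₀`-clause of the curved time web AT BASE TIME `0` (what `…CurvedEndKill.curvature_deriv_zero_at` eats)

Cell ns-regularity-ideate, stub-worker seat ns-poloidal-K2-p2 g18 under the LEAD of item 20428 (ns-poloidal-K2-p3 g17/g18);
`--supports stmt-NavierStokesRegularity-20428 --as helper`.  Memo `Cruxes/LrcModEntire/TOWER-CLOSES-port2g9.md` §D1/§E; LEAD 2026-08-29T23:13:57Z (v16: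
NON-VERTICAL child of `stub_Q4curvedAperiodic` closable by the tower at base time `0`).  Port-2 g9's kill `…CurvedEndKill.curvature_deriv_zero_at` consumed,
in case II, the `∀ σ₀`-clause of this seat's `…FermiTimeWebAt.curved_timeWeb_at` VERBATIM: a `C^∞` web function `G₁` on an `ε₁`-box around `(τ₁, σ₀, 0)` with
Fermi factor `1 − k₁G₁ ≠ 0`, signed criticality ×2, value, ridge law, slice law, Huygens family, and parallelism at `τ₁`.  This file serves the SAME dish at base
time `0` over the CURVED hot branch (from this seat's `…CurvedTimeWebAt.curved_time_web_package`, B-TWP0c C2), so that the v16 non-vertical child's kill is the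
case-II kill with `τ₁ := 0`, `G₁ := n₀` (minus the unused line-frame conjunct; the transversal window is replaced by `…CurvedWebWindowSelect.exists_tower_window`):

* `contDiff_curvature_of_frenet` (class-free) — the Frenet curvature of a `C^∞` planar unit-speed curve is `C^∞` (`k = ⟪Γ″, JΓ′⟫`);
* `exists_fermi_box` (class-free) — `n₀` continuous on the slab, `|k(s)d(z)| ≤ 1/2`, `n₀(0,s,z) = d(z)` ⇒ around every `(0, σ₀)` an `ε₁`-box with `1 − k(s)n₀ ≠ 0`
  (compactness: `IsCompact.eventually_forall_of_forall_eventually`);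
* ★ `curved_timeWeb_at_zero_of_package` (class-free bookkeeping) — C2's slab clause ⇒ `∀ σ₀, ∃ ε₁ ∈ (0, δ′]`, `ContDiffOn ℝ ∞ n₀` on the `ε₁`-box, the END′-shaped
  9-line clause on the box (signed criticality along `JΓ′` and `Γ′` via `fderiv_const_smul_field`), and parallelism `n₀(0,s,z) = n₀(0,s′,z)`;
* ★★ `curved_timeWeb_at_zero` (class level) — hypotheses of `curved_time_web_package` VERBATIM ⊢ its conclusion PLUS `ContDiff ℝ ∞ k`, `ContDiffOn ℝ ∞ d (Ioo (−δ′) δ′)`,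
  `0 < κt`, `μ < 1` as slab statements, and the local `∀ σ₀`-clause — ONE call for the v16 non-vertical child;
* `offset_ne_zero_of_centre_ne`, `offset_eq_zero_of_centre_eq` (class-free) — the bridge between a binder-currency vertical/non-vertical literal
  «`σ·U₂(−1)(Γ s + z·e₂) = R(0,z)`» and the offset: `d z = 0 ⇔` the centre of the cross-section is the maximiser.

WHAT THIS IS NOT: not a claim about Navier–Stokes regularity; closes nothing; the v16 literal and the child assembly are the LEAD's / port-2's; items
20428 / 19708 / 27893 OPEN (bears_on LADDER-NS N0).
-/

noncomputable section

set_option linter.dupNamespace false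
set_option linter.style.longLine false

namespace Summit.NavierStokesRegularity.NavierStokesRegularity.Theorems.PoloidalWindowDoorLrcModEntireCurvedTimeWebAtZero

open Set Function Filter Topology Metric
open scoped RealInnerProductSpace InnerProductSpace Laplacian ContDiff
open Literature.Analysis Literature.Analysis.FluidPDE Literature.Analysis.UnboundedOperators
open Summit.NavierStokesRegularity.NavierStokesRegularity.Theorems
open Summit.NavierStokesRegularity.NavierStokesRegularity.Theorems.PoloidalWindowDoorLrcModEntireSheetFlattenTools
open Summit.NavierStokesRegularity.NavierStokesRegularity.Theorems.PoloidalWindowDoorLrcModEntireRidgeGlobalBranchFrame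
open Summit.NavierStokesRegularity.NavierStokesRegularity.Theorems.PoloidalWindowDoorLrcModEntirePlanarCurveRigidity
open Summit.NavierStokesRegularity.NavierStokesRegularity.Theorems.PoloidalWindowDoorLrcModEntireCurvedWebTools
open Summit.NavierStokesRegularity.NavierStokesRegularity.Theorems.PoloidalWindowDoorLrcModEntireCurvedTimeWebAt

/-- **The Frenet curvature of a `C^∞` planar unit-speed curve is `C^∞`**: from `Γ″ = k·JΓ′` and `‖JΓ′‖ = 1`, `k = ⟪Γ″, JΓ′⟫`. -/
theorem contDiff_curvature_of_frenet {Γ : ℝ → EuclideanSpace ℝ (Fin 3)} {k : ℝ → ℝ} (hΓ : ContDiff ℝ ∞ Γ) (hΓ2 : ∀ s, Γ s 2 = 0)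
    (hun : ∀ s, ‖deriv Γ s‖ = 1) (hk : ∀ s, deriv (deriv Γ) s = k s • rotJ (deriv Γ s)) : ContDiff ℝ ∞ k := by
  have hΓc2 : ContDiff ℝ 2 Γ := hΓ.of_le (by norm_cast)
  have hT2 : ∀ s, deriv Γ s 2 = 0 := fun s => (deriv_horizontal hΓc2 hΓ2 s).1
  have hJ1 : ∀ s, ‖rotJ (deriv Γ s)‖ = 1 := fun s => (rotJ_facts (hT2 s) (hun s)).2.1
  have hkeq : k = fun s => ⟪deriv (deriv Γ) s, rotJ (deriv Γ s)⟫ := by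
    funext s
    rw [hk s, real_inner_smul_left, real_inner_self_eq_norm_sq, hJ1 s]; ring
  have hTi : ContDiff ℝ ∞ (deriv Γ) := hΓ.deriv'
  have hT'i : ContDiff ℝ ∞ (deriv (deriv Γ)) := by
    have h : ContDiff ℝ (∞ + 1) (deriv Γ) := by simpa using hTi
    exact h.deriv'
  rw [hkeq]
  exact hT'i.inner ℝ (contDiff_rotJ.comp hTi)

/-- **A uniform Fermi box around every base point** (class-free): `n₀` continuous on the slab `|τ|,|z| < δ′`, `k` continuous, `|k(s)d(z)| ≤ 1/2` and
`n₀(0,s,z) = d(z)` on the slab ⇒ for every `σ₀` an `ε₁ ∈ (0, δ′]` with `1 − k(s)·n₀(τ,s,z) ≠ 0` for `|τ|, |s − σ₀|, |z| < ε₁`. -/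
theorem exists_fermi_box {n₀ : ℝ × ℝ × ℝ → ℝ} {k d : ℝ → ℝ} {δ' : ℝ} (hδ' : 0 < δ')
    (hC : ∀ q : ℝ × ℝ × ℝ, |q.1| < δ' → |q.2.2| < δ' → ContinuousAt n₀ q) (hkc : Continuous k)
    (hJ : ∀ z : ℝ, |z| < δ' → ∀ s, |k s * d z| ≤ 1 / 2) (hpar : ∀ s z : ℝ, |z| < δ' → n₀ ((0 : ℝ), s, z) = d z) (σ₀ : ℝ) :
    ∃ ε₁ : ℝ, 0 < ε₁ ∧ ε₁ ≤ δ' ∧ ∀ q : ℝ × ℝ × ℝ, |q.1| < ε₁ → |q.2.1 - σ₀| < ε₁ → |q.2.2| < ε₁ → 1 - k q.2.1 * n₀ q ≠ 0 := by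
  set K : Set (ℝ × ℝ) := Icc (σ₀ - 1) (σ₀ + 1) ×ˢ Icc (-(δ' / 2)) (δ' / 2) with hK_def
  have hK : IsCompact K := isCompact_Icc.prod isCompact_Icc
  have h0 : |(0 : ℝ)| < δ' := by simpa using hδ'
  have hkw : Continuous fun w : ℝ × ℝ × ℝ => k w.2.1 := by fun_prop
  have hP : ∀ y ∈ K, ∀ᶠ w : ℝ × ℝ × ℝ in 𝓝 ((0 : ℝ), y), 1 - k w.2.1 * n₀ w ≠ 0 := by
    rintro ⟨s, z⟩ ⟨-, hz⟩
    have hzδ : |z| < δ' := by rw [abs_lt]; constructor <;> linarith [hz.1, hz.2]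
    have hcont : ContinuousAt (fun w : ℝ × ℝ × ℝ => 1 - k w.2.1 * n₀ w) ((0 : ℝ), s, z) :=
      continuousAt_const.sub (hkw.continuousAt.mul (hC ((0 : ℝ), s, z) h0 hzδ))
    have hval : (1 : ℝ) / 4 < 1 - k s * n₀ ((0 : ℝ), s, z) := by
      rw [hpar s z hzδ]; have h := (abs_le.1 (hJ z hzδ s)).2; linarith
    have hev : ∀ᶠ w : ℝ × ℝ × ℝ in 𝓝 ((0 : ℝ), s, z), (1 : ℝ) / 4 < 1 - k w.2.1 * n₀ w := hcont.preimage_mem_nhds (Ioi_mem_nhds hval)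
    exact hev.mono fun w hw h0w => by rw [h0w] at hw; norm_num at hw
  have hall := hK.eventually_forall_of_forall_eventually (x₀ := (0 : ℝ)) (P := fun τ y => 1 - k y.1 * n₀ (τ, y) ≠ 0) hP
  obtain ⟨ε, hε, hballε⟩ := Metric.eventually_nhds_iff.1 hall
  refine ⟨min ε (min 1 (δ' / 2)), by positivity, le_trans (min_le_right _ _) (le_trans (min_le_right _ _) (by linarith)), fun q h1 h2 h3 => ?_⟩
  have h1' : |q.1| < ε := lt_of_lt_of_le h1 (min_le_left _ _)
  have h2' : |q.2.1 - σ₀| < 1 := lt_of_lt_of_le h2 (le_trans (min_le_right _ _) (min_le_left _ _))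
  have h3' : |q.2.2| < δ' / 2 := lt_of_lt_of_le h3 (le_trans (min_le_right _ _) (min_le_right _ _))
  have hmem : q.2 ∈ K := ⟨⟨by linarith [(abs_lt.1 h2').1], by linarith [(abs_lt.1 h2').2]⟩, ⟨by linarith [(abs_lt.1 h3').1], by linarith [(abs_lt.1 h3').2]⟩⟩
  exact hballε (by rw [Real.dist_eq, sub_zero]; exact h1') q.2 hmem

/-- Signed/unsigned slice derivative: `D(σ·θ)(x)[w] = σ·Dθ(x)[w]` (no differentiability needed over a field). -/
theorem fderiv_signed_apply (U : ℝ → EuclideanSpace ℝ (Fin 3) → EuclideanSpace ℝ (Fin 3)) (σ t : ℝ) (x w : EuclideanSpace ℝ (Fin 3)) :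
    fderiv ℝ (fun y => σ * U t y 2) x w = σ * fderiv ℝ (fun y => U t y 2) x w := by
  have hsm : (fun y => σ * U t y 2) = σ • (fun y => U t y 2) := by funext y; simp [smul_eq_mul]
  rw [hsm, fderiv_const_smul_field, Pi.smul_apply, FunLike.coe_smul, Pi.smul_apply, smul_eq_mul]

/-- ★ **B-TWP0c IN END′ CURRENCY (class-free bookkeeping).**  The slab clause of `curved_time_web_package` (hypothesis `hbox`, verbatim), the parallel webs
`n₀(0,s,z) = d z`, `|k(s)d(z)| ≤ 1/2`, `k` differentiable and `Γ ∈ C²` planar ⇒ for every base point `σ₀` an `ε₁`-box on which port-2 g9's kill hypotheses hold. -/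
theorem curved_timeWeb_at_zero_of_package {U : ℝ → EuclideanSpace ℝ (Fin 3) → EuclideanSpace ℝ (Fin 3)} {Γ : ℝ → EuclideanSpace ℝ (Fin 3)} {R μ κt : ℝ → ℝ → ℝ}
    {n₀ : ℝ × ℝ × ℝ → ℝ} {k d : ℝ → ℝ} {σ r δ' : ℝ} (hδ' : 0 < δ') (hΓ : ContDiff ℝ 2 Γ) (hΓ2 : ∀ s, Γ s 2 = 0)
    (hkd : Differentiable ℝ k) (hJ : ∀ z : ℝ, |z| < δ' → ∀ s, |k s * d z| ≤ 1 / 2)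
    (hbox : ∀ q : ℝ × ℝ × ℝ, |q.1| < δ' → |q.2.2| < δ' →
        n₀ q ∈ Ioo (-r) r ∧
        σ * U (-1 + q.1) (Γ q.2.1 + n₀ q • rotJ (deriv Γ q.2.1) + q.2.2 • e2) 2 = R q.1 q.2.2 ∧
        (∀ n ∈ Icc (-r) r, n ≠ n₀ q → σ * U (-1 + q.1) (Γ q.2.1 + n • rotJ (deriv Γ q.2.1) + q.2.2 • e2) 2 < R q.1 q.2.2) ∧
        (∀ w : EuclideanSpace ℝ (Fin 3), w 2 = 0 → fderiv ℝ (fun y => U (-1 + q.1) y 2) (Γ q.2.1 + n₀ q • rotJ (deriv Γ q.2.1) + q.2.2 • e2) w = 0) ∧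
        (∀ m : ℕ∞, ContDiffAt ℝ m n₀ q) ∧
        0 < κt q.1 q.2.2 ∧ μ (-1 + q.1) q.2.2 < 1 ∧
        fderiv ℝ (fderiv ℝ (fun y => σ * U (-1 + q.1) y 2)) (Γ q.2.1 + n₀ q • rotJ (deriv Γ q.2.1) + q.2.2 • e2) (deriv Γ q.2.1) (deriv Γ q.2.1) +
            fderiv ℝ (fderiv ℝ (fun y => σ * U (-1 + q.1) y 2)) (Γ q.2.1 + n₀ q • rotJ (deriv Γ q.2.1) + q.2.2 • e2)
              (rotJ (deriv Γ q.2.1)) (rotJ (deriv Γ q.2.1)) = -κt q.1 q.2.2 ∧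
        fderiv ℝ (fderiv ℝ (fun y => σ * U (-1 + q.1) y 2)) (Γ q.2.1 + n₀ q • rotJ (deriv Γ q.2.1) + q.2.2 • e2) e2 e2 =
          -μ (-1 + q.1) q.2.2 *
            (fderiv ℝ (fderiv ℝ (fun y => σ * U (-1 + q.1) y 2)) (Γ q.2.1 + n₀ q • rotJ (deriv Γ q.2.1) + q.2.2 • e2) (deriv Γ q.2.1) (deriv Γ q.2.1) +
              fderiv ℝ (fderiv ℝ (fun y => σ * U (-1 + q.1) y 2)) (Γ q.2.1 + n₀ q • rotJ (deriv Γ q.2.1) + q.2.2 • e2)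
                (rotJ (deriv Γ q.2.1)) (rotJ (deriv Γ q.2.1))) ∧
        κt q.1 q.2.2 * (1 - k q.2.1 * n₀ q) ^ 2 * (fderiv ℝ n₀ q ((0 : ℝ), (0 : ℝ), (1 : ℝ))) ^ 2 =
          (deriv (deriv (R q.1)) q.2.2 - μ (-1 + q.1) q.2.2 * κt q.1 q.2.2) *
            ((1 - k q.2.1 * n₀ q) ^ 2 + (fderiv ℝ n₀ q ((0 : ℝ), (1 : ℝ), (0 : ℝ))) ^ 2))
    (hpar : ∀ s z : ℝ, |z| < δ' → n₀ ((0 : ℝ), s, z) = d z) :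
    ∀ σ₀ : ℝ, ∃ ε₁ : ℝ, 0 < ε₁ ∧ ε₁ ≤ δ' ∧
      ContDiffOn ℝ ∞ n₀ {q : ℝ × ℝ × ℝ | |q.1| < ε₁ ∧ |q.2.1 - σ₀| < ε₁ ∧ |q.2.2| < ε₁} ∧
      (∀ q : ℝ × ℝ × ℝ, |q.1| < ε₁ → |q.2.1 - σ₀| < ε₁ → |q.2.2| < ε₁ →
        |q.1| < δ' ∧ |q.2.2| < δ' ∧ 1 - k q.2.1 * n₀ q ≠ 0 ∧
        fderiv ℝ (fun y => σ * U (-1 + q.1) y 2) (Γ q.2.1 + n₀ q • rotJ (deriv Γ q.2.1) + q.2.2 • e2) (rotJ (deriv Γ q.2.1)) = 0 ∧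
        fderiv ℝ (fun y => σ * U (-1 + q.1) y 2) (Γ q.2.1 + n₀ q • rotJ (deriv Γ q.2.1) + q.2.2 • e2) (deriv Γ q.2.1) = 0 ∧
        σ * U (-1 + q.1) (Γ q.2.1 + n₀ q • rotJ (deriv Γ q.2.1) + q.2.2 • e2) 2 = R q.1 q.2.2 ∧
        fderiv ℝ (fderiv ℝ (fun y => σ * U (-1 + q.1) y 2)) (Γ q.2.1 + n₀ q • rotJ (deriv Γ q.2.1) + q.2.2 • e2) (deriv Γ q.2.1) (deriv Γ q.2.1) +
            fderiv ℝ (fderiv ℝ (fun y => σ * U (-1 + q.1) y 2)) (Γ q.2.1 + n₀ q • rotJ (deriv Γ q.2.1) + q.2.2 • e2)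
              (rotJ (deriv Γ q.2.1)) (rotJ (deriv Γ q.2.1)) = -κt q.1 q.2.2 ∧
        fderiv ℝ (fderiv ℝ (fun y => σ * U (-1 + q.1) y 2)) (Γ q.2.1 + n₀ q • rotJ (deriv Γ q.2.1) + q.2.2 • e2) e2 e2 =
          -μ (-1 + q.1) q.2.2 *
            (fderiv ℝ (fderiv ℝ (fun y => σ * U (-1 + q.1) y 2)) (Γ q.2.1 + n₀ q • rotJ (deriv Γ q.2.1) + q.2.2 • e2) (deriv Γ q.2.1) (deriv Γ q.2.1) +
              fderiv ℝ (fderiv ℝ (fun y => σ * U (-1 + q.1) y 2)) (Γ q.2.1 + n₀ q • rotJ (deriv Γ q.2.1) + q.2.2 • e2)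
                (rotJ (deriv Γ q.2.1)) (rotJ (deriv Γ q.2.1))) ∧
        κt q.1 q.2.2 * (1 - k q.2.1 * n₀ q) ^ 2 * (fderiv ℝ n₀ q ((0 : ℝ), (0 : ℝ), (1 : ℝ))) ^ 2 =
          (deriv (deriv (R q.1)) q.2.2 - μ (-1 + q.1) q.2.2 * κt q.1 q.2.2) *
            ((1 - k q.2.1 * n₀ q) ^ 2 + (fderiv ℝ n₀ q ((0 : ℝ), (1 : ℝ), (0 : ℝ))) ^ 2)) ∧
      (∀ s s' z : ℝ, |s - σ₀| < ε₁ → |s' - σ₀| < ε₁ → |z| < ε₁ → n₀ ((0 : ℝ), s, z) = n₀ ((0 : ℝ), s', z)) := by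
  intro σ₀
  have hcont : ∀ q : ℝ × ℝ × ℝ, |q.1| < δ' → |q.2.2| < δ' → ContinuousAt n₀ q := fun q h1 h2 => ((hbox q h1 h2).2.2.2.2.1 0).continuousAt
  obtain ⟨ε₁, hε₁, hε₁δ, hJq⟩ := exists_fermi_box hδ' hcont hkd.continuous hJ hpar σ₀
  have hT2 : ∀ s, deriv Γ s 2 = 0 := fun s => (deriv_horizontal hΓ hΓ2 s).1
  have hJ2 : ∀ s, rotJ (deriv Γ s) 2 = 0 := fun s => (rotJ_apply (deriv Γ s)).2.2
  refine ⟨ε₁, hε₁, hε₁δ, ?_, ?_, ?_⟩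
  · intro q hq
    have h := (hbox q (lt_of_lt_of_le hq.1 hε₁δ) (lt_of_lt_of_le hq.2.2 hε₁δ)).2.2.2.2.1 (⊤ : ℕ∞)
    exact (h : ContDiffAt ℝ ∞ n₀ q).contDiffWithinAt
  · intro q h1 h2 h3
    have h1' : |q.1| < δ' := lt_of_lt_of_le h1 hε₁δ
    have h3' : |q.2.2| < δ' := lt_of_lt_of_le h3 hε₁δ
    obtain ⟨-, hval, -, hcrit, -, -, -, hridge, hslice, hH⟩ := hbox q h1' h3'
    refine ⟨h1', h3', hJq q h1 h2 h3, ?_, ?_, hval, hridge, hslice, hH⟩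
    · rw [fderiv_signed_apply, hcrit _ (hJ2 q.2.1), mul_zero]
    · rw [fderiv_signed_apply, hcrit _ (hT2 q.2.1), mul_zero]
  · intro s s' z _ _ hz
    have hz' : |z| < δ' := lt_of_lt_of_le hz hε₁δ
    rw [hpar s z hz', hpar s' z hz']

/-- **Literal bridge, non-vertical side** (class-free): if the CENTRE of the cross-section at `(s, z)` does not carry the ridge height — `σ·U₂(−1)(Γ s + z·e₂) ≠ R(0,z)` —
then the parallel offset is non-zero there: `d z ≠ 0` (value law at the web point + `n₀(0,s,z) = d z`). -/
theorem offset_ne_zero_of_centre_ne {U : ℝ → EuclideanSpace ℝ (Fin 3) → EuclideanSpace ℝ (Fin 3)} {Γ : ℝ → EuclideanSpace ℝ (Fin 3)} {R : ℝ → ℝ → ℝ}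
    {n₀ : ℝ × ℝ × ℝ → ℝ} {d : ℝ → ℝ} {σ s z : ℝ}
    (hval : σ * U (-1 + (0 : ℝ)) (Γ s + n₀ ((0 : ℝ), s, z) • rotJ (deriv Γ s) + z • e2) 2 = R 0 z) (hpar : n₀ ((0 : ℝ), s, z) = d z)
    (hne : σ * U (-1) (Γ s + z • e2) 2 ≠ R 0 z) : d z ≠ 0 := by
  intro h0
  rw [hpar, h0, zero_smul, add_zero, add_zero] at hval
  exact hne hval

/-- **Literal bridge, vertical side** (class-free): if the centre DOES carry the ridge height — `σ·U₂(−1)(Γ s + z·e₂) = R(0,z)` — then by uniqueness of the maximiser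
on `[−r, r] ∋ 0` the offset vanishes: `d z = 0`. -/
theorem offset_eq_zero_of_centre_eq {U : ℝ → EuclideanSpace ℝ (Fin 3) → EuclideanSpace ℝ (Fin 3)} {Γ : ℝ → EuclideanSpace ℝ (Fin 3)} {R : ℝ → ℝ → ℝ}
    {n₀ : ℝ × ℝ × ℝ → ℝ} {d : ℝ → ℝ} {σ r s z : ℝ} (hr : 0 < r)
    (huniq : ∀ n ∈ Icc (-r) r, n ≠ n₀ ((0 : ℝ), s, z) → σ * U (-1 + (0 : ℝ)) (Γ s + n • rotJ (deriv Γ s) + z • e2) 2 < R 0 z)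
    (hpar : n₀ ((0 : ℝ), s, z) = d z) (heq : σ * U (-1) (Γ s + z • e2) 2 = R 0 z) : d z = 0 := by
  by_contra h0
  have hne : (0 : ℝ) ≠ n₀ ((0 : ℝ), s, z) := by rw [hpar]; exact fun h => h0 h.symm
  have h := huniq 0 ⟨by linarith, hr.le⟩ hne
  rw [zero_smul, add_zero, add_zero, heq] at h
  exact lt_irrefl _ h

/-- ★★ **B-TWP0c, ONE CALL (class level).**  Hypotheses of `…CurvedTimeWebAt.curved_time_web_package` VERBATIM (the (Q4) binders over an arbitrary `C^∞` unit-speed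
horizontal hot branch `Γ`; no line literal, no sonic literal, no verticality literal) ⊢ its conclusion PLUS `ContDiff ℝ ∞ k`, `ContDiffOn ℝ ∞ d (Ioo (−δ′) δ′)`, the slab
scalars `0 < κt`, `μ < 1`, and the local `∀ σ₀`-clause in the currency of `…CurvedEndKill.curvature_deriv_zero_at` (with `τ₁ := 0`, `G₁ := n₀`). -/
theorem curved_timeWeb_at_zero {C : ℝ} {U : ℝ → EuclideanSpace ℝ (Fin 3) → EuclideanSpace ℝ (Fin 3)} {Γ νΓ : ℝ → EuclideanSpace ℝ (Fin 3)} {R μ : ℝ → ℝ → ℝ}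
    {σ κ r δ ρ : ℝ}
    (hUrate : HasTypeITimeDecay C U) (hUcont : ContinuousOn (uncurry U) (Iio (0 : ℝ) ×ˢ univ))
    (hUmild : ∀ s t : ℝ, s < t → t < 0 → ∀ x, U t x = heatExtension (U s) (t - s) x - oseenDuhamel 1 s U U t x)
    (hUdiv : ∀ t < 0, VectorCalculus.IsDivFree (U t))
    (hUpol : ∀ s < 0, ∀ q, ⟪curl (U s) q, EuclideanSpace.single 2 1⟫_ℝ = 0)
    (hUne : U (-1) 0 2 ≠ 0) (hUhotbd : ∀ t < 0, ∀ x, Real.sqrt (-t) * |U t x 2| ≤ |U (-1) 0 2|)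
    (hUcrit : ∀ y ∈ {y : EuclideanSpace ℝ (Fin 3) | y 2 = 0 ∧ U (-1) y 2 = U (-1) 0 2}, fderiv ℝ (fun x => U (-1) x 2) y = 0)
    (hσ : σ = 1 ∨ σ = -1) (hσN : σ * U (-1) 0 2 = |U (-1) 0 2|) (hκ : 0 < κ)
    (hΓ : ContDiff ℝ ∞ Γ) (hΓ2 : ∀ s, Γ s 2 = 0) (hΓunit : ∀ s, ‖deriv Γ s‖ = 1) (hΓhot : ∀ s, U (-1) (Γ s) 2 = U (-1) 0 2)
    (hν : ∀ s, νΓ s = WithLp.toLp 2 ![-(deriv Γ s 1), deriv Γ s 0, 0])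
    (hΓcurv : ∀ s, κ ≤ -(fderiv ℝ (fderiv ℝ (fun y => σ * U (-1) y 2)) (Γ s) (νΓ s) (νΓ s)))
    (hr : 0 < r) (hδ : 0 < δ)
    (hconc : ∀ τ z : ℝ, |τ| < δ → |z| < δ → ∀ s : ℝ, ∀ n ∈ Ioo (-r) r,
      fderiv ℝ (fderiv ℝ (fun y => σ * U (-1 + τ) y 2)) (Γ s + n • νΓ s + z • EuclideanSpace.single 2 (1 : ℝ)) (νΓ s) (νΓ s) < 0)
    (hweb : ∀ τ₀ z₀ : ℝ, |τ₀| < δ → |z₀| < δ → ∀ s₀ : ℝ, ∃ n₀ ∈ Ioo (-r) r,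
      σ * U (-1 + τ₀) (Γ s₀ + n₀ • νΓ s₀ + z₀ • EuclideanSpace.single 2 (1 : ℝ)) 2 = R τ₀ z₀ ∧
      (∀ n ∈ Icc (-r) r, n ≠ n₀ → σ * U (-1 + τ₀) (Γ s₀ + n • νΓ s₀ + z₀ • EuclideanSpace.single 2 (1 : ℝ)) 2 < R τ₀ z₀) ∧
      DifferentiableAt ℝ (uncurry R) (τ₀, z₀) ∧
      fderiv ℝ (uncurry fun τ y => σ * U (-1 + τ) y 2) (τ₀, Γ s₀ + n₀ • νΓ s₀ + z₀ • EuclideanSpace.single 2 (1 : ℝ)) =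
        (fderiv ℝ (uncurry R) (τ₀, z₀)).comp
          ((ContinuousLinearMap.fst ℝ ℝ (EuclideanSpace ℝ (Fin 3))).prod
            ((EuclideanSpace.proj (2 : Fin 3)).comp (ContinuousLinearMap.snd ℝ ℝ (EuclideanSpace ℝ (Fin 3))))))
    (hρ : 0 < ρ) (hμ3 : ContDiff ℝ 3 (uncurry μ))
    (hslabU : ∀ t : ℝ, |t + 1| < ρ → ∀ x : EuclideanSpace ℝ (Fin 3), |x 2| < ρ → ∀ b : Fin 3, b ≠ 2 →
      fderiv ℝ (U t) x (EuclideanSpace.single 2 1) b = μ t (x 2) * fderiv ℝ (U t) x (EuclideanSpace.single b 1) 2)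
    (hevU : ∀ t₀ : ℝ, |t₀ + 1| < ρ → ∀ y₀ : EuclideanSpace ℝ (Fin 3), y₀ 2 = 0 →
      ∀ᶠ z in 𝓝 ((t₀, y₀) : ℝ × EuclideanSpace ℝ (Fin 3)), ∀ b : Fin 3, b ≠ 2 →
        fderiv ℝ (U z.1) z.2 (EuclideanSpace.single 2 1) b = μ z.1 (z.2 2) * fderiv ℝ (U z.1) z.2 (EuclideanSpace.single b 1) 2) :
    ∃ (δ' : ℝ) (n₀ : ℝ × ℝ × ℝ → ℝ) (κt : ℝ → ℝ → ℝ) (k d : ℝ → ℝ) (K : ℝ), 0 < δ' ∧ δ' ≤ δ ∧ δ' ≤ ρ ∧ δ' < 1 / 2 ∧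
      -- the branch: Frenet law with `C^∞` bounded curvature
      (∀ s, deriv (deriv Γ) s = k s • rotJ (deriv Γ s)) ∧ ContDiff ℝ ∞ k ∧ (∀ s, |k s| ≤ K) ∧
      -- the parallel offset at `τ = 0`
      d 0 = 0 ∧ ContDiffOn ℝ ∞ d (Ioo (-δ') δ') ∧ (∀ z : ℝ, |z| < δ' → ∀ s, |k s * d z| ≤ 1 / 2) ∧
      -- slab scalars
      (∀ τ z : ℝ, |τ| < δ' → |z| < δ' → 0 < κt τ z) ∧ (∀ τ z : ℝ, |τ| < δ' → |z| < δ' → μ (-1 + τ) z < 1) ∧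
      -- the slab clause of `curved_time_web_package` (verbatim)
      (∀ q : ℝ × ℝ × ℝ, |q.1| < δ' → |q.2.2| < δ' →
        n₀ q ∈ Ioo (-r) r ∧
        σ * U (-1 + q.1) (Γ q.2.1 + n₀ q • rotJ (deriv Γ q.2.1) + q.2.2 • e2) 2 = R q.1 q.2.2 ∧
        (∀ n ∈ Icc (-r) r, n ≠ n₀ q → σ * U (-1 + q.1) (Γ q.2.1 + n • rotJ (deriv Γ q.2.1) + q.2.2 • e2) 2 < R q.1 q.2.2) ∧
        (∀ w : EuclideanSpace ℝ (Fin 3), w 2 = 0 → fderiv ℝ (fun y => U (-1 + q.1) y 2) (Γ q.2.1 + n₀ q • rotJ (deriv Γ q.2.1) + q.2.2 • e2) w = 0) ∧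
        (∀ m : ℕ∞, ContDiffAt ℝ m n₀ q) ∧
        0 < κt q.1 q.2.2 ∧ μ (-1 + q.1) q.2.2 < 1 ∧
        fderiv ℝ (fderiv ℝ (fun y => σ * U (-1 + q.1) y 2)) (Γ q.2.1 + n₀ q • rotJ (deriv Γ q.2.1) + q.2.2 • e2) (deriv Γ q.2.1) (deriv Γ q.2.1) +
            fderiv ℝ (fderiv ℝ (fun y => σ * U (-1 + q.1) y 2)) (Γ q.2.1 + n₀ q • rotJ (deriv Γ q.2.1) + q.2.2 • e2)
              (rotJ (deriv Γ q.2.1)) (rotJ (deriv Γ q.2.1)) = -κt q.1 q.2.2 ∧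
        fderiv ℝ (fderiv ℝ (fun y => σ * U (-1 + q.1) y 2)) (Γ q.2.1 + n₀ q • rotJ (deriv Γ q.2.1) + q.2.2 • e2) e2 e2 =
          -μ (-1 + q.1) q.2.2 *
            (fderiv ℝ (fderiv ℝ (fun y => σ * U (-1 + q.1) y 2)) (Γ q.2.1 + n₀ q • rotJ (deriv Γ q.2.1) + q.2.2 • e2) (deriv Γ q.2.1) (deriv Γ q.2.1) +
              fderiv ℝ (fderiv ℝ (fun y => σ * U (-1 + q.1) y 2)) (Γ q.2.1 + n₀ q • rotJ (deriv Γ q.2.1) + q.2.2 • e2)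
                (rotJ (deriv Γ q.2.1)) (rotJ (deriv Γ q.2.1))) ∧
        κt q.1 q.2.2 * (1 - k q.2.1 * n₀ q) ^ 2 * (fderiv ℝ n₀ q ((0 : ℝ), (0 : ℝ), (1 : ℝ))) ^ 2 =
          (deriv (deriv (R q.1)) q.2.2 - μ (-1 + q.1) q.2.2 * κt q.1 q.2.2) *
            ((1 - k q.2.1 * n₀ q) ^ 2 + (fderiv ℝ n₀ q ((0 : ℝ), (1 : ℝ), (0 : ℝ))) ^ 2)) ∧
      -- parallel webs at `τ = 0`
      (∀ s z : ℝ, |z| < δ' → n₀ ((0 : ℝ), s, z) = d z) ∧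
      -- ★ the local `∀ σ₀`-clause in END′ currency
      (∀ σ₀ : ℝ, ∃ ε₁ : ℝ, 0 < ε₁ ∧ ε₁ ≤ δ' ∧
        ContDiffOn ℝ ∞ n₀ {q : ℝ × ℝ × ℝ | |q.1| < ε₁ ∧ |q.2.1 - σ₀| < ε₁ ∧ |q.2.2| < ε₁} ∧
        (∀ q : ℝ × ℝ × ℝ, |q.1| < ε₁ → |q.2.1 - σ₀| < ε₁ → |q.2.2| < ε₁ →
          |q.1| < δ' ∧ |q.2.2| < δ' ∧ 1 - k q.2.1 * n₀ q ≠ 0 ∧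
          fderiv ℝ (fun y => σ * U (-1 + q.1) y 2) (Γ q.2.1 + n₀ q • rotJ (deriv Γ q.2.1) + q.2.2 • e2) (rotJ (deriv Γ q.2.1)) = 0 ∧
          fderiv ℝ (fun y => σ * U (-1 + q.1) y 2) (Γ q.2.1 + n₀ q • rotJ (deriv Γ q.2.1) + q.2.2 • e2) (deriv Γ q.2.1) = 0 ∧
          σ * U (-1 + q.1) (Γ q.2.1 + n₀ q • rotJ (deriv Γ q.2.1) + q.2.2 • e2) 2 = R q.1 q.2.2 ∧
          fderiv ℝ (fderiv ℝ (fun y => σ * U (-1 + q.1) y 2)) (Γ q.2.1 + n₀ q • rotJ (deriv Γ q.2.1) + q.2.2 • e2) (deriv Γ q.2.1) (deriv Γ q.2.1) +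
              fderiv ℝ (fderiv ℝ (fun y => σ * U (-1 + q.1) y 2)) (Γ q.2.1 + n₀ q • rotJ (deriv Γ q.2.1) + q.2.2 • e2)
                (rotJ (deriv Γ q.2.1)) (rotJ (deriv Γ q.2.1)) = -κt q.1 q.2.2 ∧
          fderiv ℝ (fderiv ℝ (fun y => σ * U (-1 + q.1) y 2)) (Γ q.2.1 + n₀ q • rotJ (deriv Γ q.2.1) + q.2.2 • e2) e2 e2 =
            -μ (-1 + q.1) q.2.2 *
              (fderiv ℝ (fderiv ℝ (fun y => σ * U (-1 + q.1) y 2)) (Γ q.2.1 + n₀ q • rotJ (deriv Γ q.2.1) + q.2.2 • e2) (deriv Γ q.2.1) (deriv Γ q.2.1) +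
                fderiv ℝ (fderiv ℝ (fun y => σ * U (-1 + q.1) y 2)) (Γ q.2.1 + n₀ q • rotJ (deriv Γ q.2.1) + q.2.2 • e2)
                  (rotJ (deriv Γ q.2.1)) (rotJ (deriv Γ q.2.1))) ∧
          κt q.1 q.2.2 * (1 - k q.2.1 * n₀ q) ^ 2 * (fderiv ℝ n₀ q ((0 : ℝ), (0 : ℝ), (1 : ℝ))) ^ 2 =
            (deriv (deriv (R q.1)) q.2.2 - μ (-1 + q.1) q.2.2 * κt q.1 q.2.2) *
              ((1 - k q.2.1 * n₀ q) ^ 2 + (fderiv ℝ n₀ q ((0 : ℝ), (1 : ℝ), (0 : ℝ))) ^ 2)) ∧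
        (∀ s s' z : ℝ, |s - σ₀| < ε₁ → |s' - σ₀| < ε₁ → |z| < ε₁ → n₀ ((0 : ℝ), s, z) = n₀ ((0 : ℝ), s', z))) := by
  obtain ⟨δ', n₀, κt, k, d, K, hδ', hδ'δ, hδ'ρ, hδ'h, hfr, hkd, hkK, hd0, hdC, hJ, hbox, hpar⟩ :=
    curved_time_web_package hUrate hUcont hUmild hUdiv hUpol hUne hUhotbd hUcrit hσ hσN hκ hΓ hΓ2 hΓunit hΓhot hν hΓcurv hr hδ hconc hweb hρ hμ3 hslabU hevU
  have hkC : ContDiff ℝ ∞ k := contDiff_curvature_of_frenet hΓ hΓ2 hΓunit hfr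
  have hdOn : ContDiffOn ℝ ∞ d (Ioo (-δ') δ') := fun z hz => (hdC z (abs_lt.2 ⟨hz.1, hz.2⟩)).contDiffWithinAt
  have hκt : ∀ τ z : ℝ, |τ| < δ' → |z| < δ' → 0 < κt τ z := fun τ z h1 h2 => (hbox (τ, (0 : ℝ), z) h1 h2).2.2.2.2.2.1
  have hμ1 : ∀ τ z : ℝ, |τ| < δ' → |z| < δ' → μ (-1 + τ) z < 1 := fun τ z h1 h2 => (hbox (τ, (0 : ℝ), z) h1 h2).2.2.2.2.2.2.1
  have hloc := curved_timeWeb_at_zero_of_package hδ' (hΓ.of_le (by norm_cast)) hΓ2 hkd hJ hbox hpar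
  exact ⟨δ', n₀, κt, k, d, K, hδ', hδ'δ, hδ'ρ, hδ'h, hfr, hkC, hkK, hd0, hdOn, hJ, hκt, hμ1, hbox, hpar, hloc⟩

end Summit.NavierStokesRegularity.NavierStokesRegularity.Theorems.PoloidalWindowDoorLrcModEntireCurvedTimeWebAtZero

end
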